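/-
Copyright (c) 2026 the pub-hodgecm-mathlib formalisation cell (harness21).  Prover seat hodgecm-mathlib-LH4-p13 (g10), req620 Track A «(D-RAM) FOUR-FRAME» squad
F0∕P3c∕LH4; the (β₂) road (R-36), β₂ WORDs #34∕#36 «THE MIX-HI WALL» (lead LH4-p13, second LH7-p09 (g3)): the two literal reads of a populated MIX-band member on the
exact-level digit; helper lane on h413 = stmt-HodgeConjecture-24833 (count-neutral).  2026-09-05.
-/
import Summits.HodgeConjecture.HodgeConjecture.Theorems.F0P3cDyRamMixHiClassForm                   -- ★ p864323 (this seat): §3 `exists_fixed_unit_valueSet_eq_smul_xPlus_of_shell_offBlock` (THE LABEL LAW, general block); brings ★ `…ConeCellFaceAxis`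
import Summits.HodgeConjecture.HodgeConjecture.Theorems.F0P3cDyRamCleanShellLabelRead             -- ★ p864505 (this seat): HEAD `eq_plus_iff_exists_norm_of_value_near_fixed` (class off any fixed approximant of any value)
import Summits.HodgeConjecture.HodgeConjecture.Theorems.F0P3cDyRamUpperLineRayLetters             -- ★ p864080 (LH4-p14): `exactLevel_iff_v_rayScalar_eq` (exact level `ℓ₀` ⟺ `|e₀| = |ϖ|^{ℓ₀}`)
import Summits.HodgeConjecture.HodgeConjecture.Theorems.F0P3cDyRamShellOfExactLevel                -- ★ p863487 (LH7-p09 (g2)) FILE 10: `latticeNearTransvShell_iff_exactLevel_of_prod`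
import Summits.HodgeConjecture.HodgeConjecture.Theorems.F0P3cDyRamDepthFormLineModel               -- ★ (LH4-p16): `valueSet_endoGL_sub_one_glued_eq_normFormSet_of_gen` (the value set of a glued vertex IS the norm-form set)
import Summits.HodgeConjecture.HodgeConjecture.Theorems.F0P3cDyRamLowerLineFlipFace                 -- ★ p863923 (LH7-p09): §1 `exists_glueLetters_of_gen` (glue letters of ANY presentation)
import Summits.HodgeConjecture.HodgeConjecture.Theorems.F0P3cDyRamConeCellGluedVertexExistsOfWeight -- ★ p864081 (LH7-p09): «populated ⇒ glued»; brings ★ `…ConeCellFaceTube` (`exists_fixed_unit_weight_eq_natCard_normFibre`)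
import Summits.HodgeConjecture.HodgeConjecture.Theorems.F0P3cDyRamSmulXPlusLabel                    -- ★ (LH4-p15): `valueSetMod_smul_xPlus` (the ray description of `V(e • X₊)`)
import Literature.NumberTheory.LocalFields.WildQuadraticDatumNormFibreValuesAbove                   -- ★ Lit: `natCard_normFibre_eq_zero_of_not_exists_of_le` (populated ⇒ glue norm at `d ≤ b`)
import HarnessLib

/-!
# Crux `H413`, line LH4 «(D-RAM) FOUR-FRAME» — STAGE-1b, row (2) of `f_{T₊}`, the (β₂) road (R-36), the MIX-HI WALL (β₂ WORDs #34∕#36): «THE TWO LITERAL READS OF A POPULATED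
# MIX-BAND MEMBER ON THE EXACT-LEVEL DIGIT» — for a populated member `Λ` of a cone cell `(j, b)` with `d ≤ b` under the MIX-band product letter, «∃ glued `L₃` at exact level `ℓ₀`
# with `VS_{m⋆} = V(X₊)`» is «`|e₀(Λ)| = |ϖ|^{ℓ₀}` and the product class `Π(Λ)` is the norm class», and «… with `VS_{m⋆} = V(c₀ • X₊)`» is «`|e₀(Λ)| = |ϖ|^{ℓ₀}` and `¬Π(Λ)`»

Cell `hodgecm-mathlib` (D-0151), FLOOR 0, crux item H413 = `stmt-HodgeConjecture-24833`, route of record `HCCMUnconditional`; squads F0∕P3c∕LH4 ∕ LH7; lane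
`--supports stmt-HodgeConjecture-24833 --as helper` (count-neutral; pays NO tier-0 row).  THEOREMS ONLY (no `def`, no instance, no notation, no `sorry`, default heartbeats);
★-only imports; states NO law; the MIX-HI letters and (β₂) stay HYPOTHESES.  Frame = ★ p864303 `valueSet_eq_plus_iff_prodClass_of_weight_ne_zero`'s junction frame
(block `(H₂, h_W)`, ★ (C1)'s line model, `jE` isometric, `Θ ∘ jE = jE ∘ σ`, E-side wild datum, `¬ IsUnit 2`) + the literal `(γ₂, u)` with `lam`'s characteristic polynomial and
the unitary embedding `P₁` (★ p861305 §3's general block — for the label law ★ p864323 §3) + the fence `m_c ≤ n`, `|u₀₀ − 1| ≤ |ϖ^n|`, `|lam − 1| ≤ |ϖE^n|` + the cell `(j, b)`,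
`1 ≤ b`, `d ≤ b`, `lam ∈ 𝒪_j` + FOUR CELL LETTERS in the currency `cc = ϖE^j`, `|Y| = |ϖE|^b`:
`hμl : |μ| ≤ |ϖE|^{ℓ₀+1+b}`, `hlamρ : |lam − ρlam| ≤ |cc(α − ρα)|·|ϖE|^{ℓ₀+1}` (★ p864080's level letters), `hμk : |μ| ≤ |ϖE|^{m_c − ℓ₀}`,
`hprod : |μ|·|μ − ρμ| ≤ |cc(α − ρα)|·|ϖE|^b·|ϖE|^{m_c}` (★ FILE 10's product letter) — on the `hU_mix` line (`j + m = jl + b`, `m_c + 2b ≤ 2m`) and the `hD_mix` diagonal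
(`j = b`, `jl = m`) all four hold by `omega` (`2(m − b) ≥ m_c ≥ 2(ℓ₀ + 1)` at `d ≥ 2`).

THE TWO PREDICATES (bound, with defining `Iff`s; no `def`): `Pc` = ★ p864303's PRODUCT CLASS VERBATIM («some presentation `x₀` carries a `σ`-fixed unit `r` with
`jE r = glueUnit(x₀, b)`, a ray scalar `e₀`, a `σ`-fixed unit `e′` with `|e₀ − e′·t₊| ≤ |ϖ|^{m⋆}` and `r·e′ ∈ N(E^×)`»); `NX` = ★ `…MixBandProductSocket` §1's EXACT-LEVEL DIGIT
(«some presentation has `|e₀| = |ϖ|^{ℓ₀}`»).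
HEAD `reads_of_weight_ne_zero` — for every `Λ ∈ levelSetDep(j, b; μ)` with `f b j Λ ≠ 0` and every `σ`-fixed NON-norm unit `c₀`:
  `(∃ B L₃ glued, tube_b, (exact level ℓ₀) ∧ VS_{m⋆}(L₃) = V(X₊)) ↔ (NX Λ ∧ Pc Λ)` and `(∃ B L₃ glued, tube_b, (exact level ℓ₀) ∧ VS_{m⋆}(L₃) = V(c₀ • X₊)) ↔ (NX Λ ∧ ¬ Pc Λ)`
— EXACTLY the reads `hP₁`, `hQ₁` of ★ `…MixBandProductSocket.cellDiff_eq_zero_of_flip_of_prodBalance_on` for the two-class literals of ★ p864456 (‹U-MIX-2C›) ∕ ★ p864457 (‹D-MIX-2C›).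
PROOF (no ray domination, no Step-A skewness — the MIX band has `s = m − b < m⋆`).  For ANY presentation `x₁` of `Λ` and ANY glued `L₃`, ★ `exists_glueLetters_of_gen` gives the
glue letters, whence (i) ★ p864080: «exact level `ℓ₀`» ⟺ `|e₁| = |ϖ|^{ℓ₀}` (letters `hμl hlamρ` + the fence) — so `NX` IS the exact-level conjunct, presentation-free; (ii) ★
`valueSet_endoGL_sub_one_glued_eq_normFormSet_of_gen` at `m := m⋆` (`|u₀₀ − 1| ≤ |ϖ|^{m⋆}`): the ray scalar `e₁` IS a value of `L₃` mod `ϖ^{m⋆}` (the norm-form set at `ζ = 0`,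
`a = 1`); (iii) ★ FILE 10: exact level ⟹ the `(ℓ₀, m_c)`-shell (letters `hμk hprod`), so ★ p864323 §3 LABELS the vertex: `VS_{m⋆} = V(e‴ • X₊)`.  THEN `V(X₊) → Pc`: the canonical
datum `(x₀, r₀)` (★ `exists_fixed_unit_weight_eq_natCard_normFibre`) has `r₀ ∈ N` (populated, `d ≤ b`, ★ Lit), and `e₀ ∈ V(1 • X₊)` with `|e₀| = |t₊|` gives `e₀ ≡ t₊·aσa`
(★ `valueSetMod_smul_xPlus`), so `e′ := aσa` is a fixed unit NORM `m⋆`-close to `e₀∕t₊`; `Pc → V(X₊)`: the witness's `r` is a norm (★ (C1)'s `hf` at the witness presentation),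
hence `e′` is, and ★ p864505 reads the class of the vertex off the value `e₁ ≈ e′t₊`; the `c₀`-literal by the norm dichotomy (★ `valueSetMod_smul_xPlus_eq_plus_iff_exists_norm`,
★ `valueSetMod_smul_xPlus_eq_iff_exists_norm`, ★ `exists_norm_mul_inv_of_not_norm`).
HONEST LABEL.  Count-neutral composition of ★ pieces; nothing printed is asserted; no census law is stated; ‹PRODBAL-U›∕‹PRODBAL-D›, ‹U-MIX-2C›∕‹D-MIX-2C›, the MIX-HI band
letters and (β₂) `stub_law_cleanSgn₂` stay OPEN; `HC_CM` is proved only modulo the 7 printed citations (2 remaining named inputs: hLiu418 = `stmt-HodgeConjecture-24832`, h413 =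
`stmt-HodgeConjecture-24833`) until rung 0 closes.
## References
* [Rogawski1990] J. D. Rogawski, *Automorphic Representations of Unitary Groups in Three Variables*, Ann. of Math. Stud. 123 (1990): §4.9 Prop. 4.9.1 (b) p. 55.
* [Kottwitz1986BaseChangeUnits] R. E. Kottwitz, *Base change for unit elements of Hecke algebras*, Compositio Math. 60 (1986): §1 pp. 240–241; §3.
* [Jacobowitz1962] R. Jacobowitz, *Hermitian forms over local fields*, Amer. J. Math. 84 (1962): §4 (duals, gluing, the glue unit).
* [Serre1979] J.-P. Serre, *Local Fields*, GTM 67 (1979): Ch. V §3 Prop. 5, Cor. 2–3 pp. 84–86 (norm classes of units: index two); Ch. III §6 Prop. 12.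
* [LabesseLanglands1979] J.-P. Labesse, R. P. Langlands, *L-indistinguishability for SL(2)*, Canad. J. Math. 31 (1979): §2 p. 8.
-/

set_option autoImplicit false

noncomputable section

namespace Summit.HodgeConjecture.HodgeConjecture.Cruxes.H413.F0P3cDyRamMixBandProductRead

open scoped Valued WithZero Matrix MatrixGroups Pointwise
open WithZero
open Literature.NumberTheory.Automorphic Literature.NumberTheory.Automorphic.HermitianLattice Literature.NumberTheory.Automorphic.UnitaryLatticeTree
open Literature.NumberTheory.Automorphic.UnitaryThreeFourFrame (IsRamifiedQuadraticDatum)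
open Literature.NumberTheory.Automorphic.EllipticPlaneAsFieldLine
open Literature.NumberTheory.Rogawski1990
open Literature.NumberTheory.LocalFields (isAdicComplete_valuedInteger_of_completeSpace)
open Literature.NumberTheory.LocalFields.WildQuadraticDatum (natCard_normFibre_eq_zero_of_not_exists_of_le)
open Summit.HodgeConjecture.HodgeConjecture.Cruxes.H413.F0P3cDyRamFourFramePieces
open Summit.HodgeConjecture.HodgeConjecture.Cruxes.H413.F0P3cDyRamFourFrameCensusDefs (LatticeInLevel LatticeNearTransvShell)
open Summit.HodgeConjecture.HodgeConjecture.Cruxes.H413.F0P3cDyRamStageOneBDefs (mcOfRecord mstarOfRecord_le_mcOfRecord)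
open Summit.HodgeConjecture.HodgeConjecture.Cruxes.H413.F0P3cDyRamToricCensusDefs
open Summit.HodgeConjecture.HodgeConjecture.Cruxes.H413.F0P3cDyRamConeCellFaceAxis (valueSetMod_smul_xPlus_eq_plus_iff_exists_norm valueSetMod_smul_xPlus_eq_iff_exists_norm
  exists_norm_mul_inv_of_not_norm)
open Summit.HodgeConjecture.HodgeConjecture.Cruxes.H413.F0P3cDyRamLabelShellFlipCardTwo (v_refSkew_eq)
open Summit.HodgeConjecture.HodgeConjecture.Cruxes.H413.F0P3cDyRamSmulXPlusLabel (valueSetMod_smul_xPlus)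
open Summit.HodgeConjecture.HodgeConjecture.Cruxes.H413.F0P3cDyRamMixHiClassForm (exists_fixed_unit_valueSet_eq_smul_xPlus_of_shell_offBlock)
open Summit.HodgeConjecture.HodgeConjecture.Cruxes.H413.F0P3cDyRamCleanShellLabelRead (eq_plus_iff_exists_norm_of_value_near_fixed)
open Summit.HodgeConjecture.HodgeConjecture.Cruxes.H413.F0P3cDyRamUpperLineRayLetters (exactLevel_iff_v_rayScalar_eq)
open Summit.HodgeConjecture.HodgeConjecture.Cruxes.H413.F0P3cDyRamShellOfExactLevel (latticeNearTransvShell_iff_exactLevel_of_prod)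
open Summit.HodgeConjecture.HodgeConjecture.Cruxes.H413.F0P3cDyRamDepthFormLineModel (valueSet_endoGL_sub_one_glued_eq_normFormSet_of_gen)
open Summit.HodgeConjecture.HodgeConjecture.Cruxes.H413.F0P3cDyRamLowerLineFlipFace (exists_glueLetters_of_gen)
open Summit.HodgeConjecture.HodgeConjecture.Cruxes.H413.F0P3cDyRamConeCellFaceTube (exists_fixed_unit_weight_eq_natCard_normFibre)
open Summit.HodgeConjecture.HodgeConjecture.Cruxes.H413.F0P3cDyRamConeCellGluedVertexExistsOfWeight (exists_glued_of_mem_levelSetDep_of_weight_ne_zero)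

variable {E M : Type} [Field E] [Valued E ℤᵐ⁰] [Field M] [Valued M ℤᵐ⁰] {ρ Θ : M →+* M} {α : M}

/-- **HEAD — «THE TWO LITERAL READS OF A POPULATED MIX-BAND MEMBER ON THE EXACT-LEVEL DIGIT».**  Junction frame of ★ p864303 (block `(H₂, h_W)`, ★ (C1)'s line model,
`jE` isometric, `Θ ∘ jE = jE ∘ σ`, E-side wild datum, `¬ IsUnit 2`); the literal `(γ₂, u)` with `lam`'s characteristic polynomial `hlam2 hρlam` and its unitary embedding `P₁ hA hΓ`;
the fence `m_c ≤ n`, `|u₀₀ − 1| ≤ |ϖ^n|`, `|lam − 1| ≤ |ϖE^n|`; the cell `(j, b)` with `1 ≤ b`, `d ≤ b`, `lam ∈ 𝒪_j`; the four cell letters `hμl hlamρ hμk hprod`; ★ (C1)'s weight letter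
`hf`; the exact-level digit `NX` and the product class `Pc` with their defining `Iff`s; a `σ`-fixed non-norm unit `c₀`.  THEN for every member `Λ` of `levelSetDep(j, b; lam − jE u₀₀)`
with `f b j Λ ≠ 0`: `(«∃ glued L₃, tube_b, exact level ℓ₀ ∧ VS_{m⋆} = V(X₊)» ↔ NX Λ ∧ Pc Λ) ∧ («∃ glued L₃, tube_b, exact level ℓ₀ ∧ VS_{m⋆} = V(c₀ • X₊)» ↔ NX Λ ∧ ¬ Pc Λ)`.
[cite: Rogawski1990, §4.9 Prop. 4.9.1 (b) p. 55] [cite: Kottwitz1986BaseChangeUnits, §1 pp. 240–241; §3] [cite: Serre1979, Ch. V §3 Prop. 5, Cor. 2–3 pp. 84–86] [cite: Jacobowitz1962, §4]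
[cite: LabesseLanglands1979, §2 p. 8] -/
theorem reads_of_weight_ne_zero [CompleteSpace E] [IsDiscreteValuationRing 𝒪[E]] [Finite 𝓀[E]]
    (σ : E →+* E) (hσ : ∀ a, σ (σ a) = a) (hvσ : ∀ a, Valued.v (σ a) = Valued.v a) {ϖ : E} (hϖ : Valued.v ϖ = exp (-1 : ℤ))
    {d t : ℕ} (hD : IsRamifiedQuadraticDatum σ ϖ d t) (h2 : ¬ IsUnit (2 : 𝒪[E]))
    {H₂ : Matrix (Fin 2) (Fin 2) E} (hH₂ : IsUnit H₂.det) (hH₂σ : (H₂.map σ)ᵀ = H₂) {hW : E} (hhW : Valued.v hW = 1) (hhWσ : σ hW = hW)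
    (jE : E →+* M) (hρρ : ∀ x, ρ (ρ x) = x) (hvρ : ∀ x, Valued.v (ρ x) = Valued.v x) (hα : ρ α ≠ α) (hα1 : Valued.v α ≤ 1)
    (hint : ∀ z : M, Valued.v z ≤ 1 → Valued.v ((z - ρ z) / (α - ρ α)) ≤ 1)
    (hΘΘ : ∀ x, Θ (Θ x) = x) (hΘρ : ∀ x, Θ (ρ x) = ρ (Θ x)) (hvΘ : ∀ x, Valued.v (Θ x) = Valued.v x) (hΘj : ∀ c, Θ (jE c) = jE (σ c))
    (hjv : ∀ c, Valued.v (jE c) ≤ 1 ↔ Valued.v c ≤ 1) (hjiso : ∀ c, Valued.v (jE c) = Valued.v c) (hjfix : ∀ z, ρ z = z ↔ ∃ c, jE c = z)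
    (hjpow : ∀ (t : E) (n : ℤ), Valued.v (jE t) = Valued.v (jE ϖ) ^ n ↔ Valued.v t = Valued.v ϖ ^ n)
    (hϖmax : ∀ t : M, ρ t = t → Valued.v t < 1 → Valued.v t ≤ Valued.v (jE ϖ))
    (φ : (Fin 2 → E) →+ M) (hφs : ∀ (c : E) (x : Fin 2 → E), φ (c • x) = jE c * φ x) (hφi : Function.Injective φ) (hφo : Function.Surjective φ)
    {γ₂ : GL (Fin 2) E} {lam h : M} (hφγ : ∀ x, φ ((γ₂ : Matrix (Fin 2) (Fin 2) E).mulVec x) = lam * φ x) (hlam : Valued.v lam = 1)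
    (hΘh : Θ h = h) (hh : h ≠ 0) (hform : ∀ x y, jE (pairing σ H₂ x y) = h * Θ (φ x) * φ y + ρ (h * Θ (φ x) * φ y))
    -- the literal `(γ₂, u)`: `lam`'s characteristic polynomial and the unitary embedding (★ p861305 §3's general block, for the label law ★ p864323 §3)
    (hlam2 : lam * lam = jE (γ₂ : Matrix (Fin 2) (Fin 2) E).trace * lam - jE (γ₂ : Matrix (Fin 2) (Fin 2) E).det)
    (hρlam : ρ lam = jE (γ₂ : Matrix (Fin 2) (Fin 2) E).trace - lam) (u : GL (Fin 1) E)
    (P₁ : GL (Fin 3) E) (hA : formCongr σ P₁ ((StdForm.antidiagonal 3).over E) = (!![H₂ 0 0, 0, H₂ 0 1; 0, hW, 0; H₂ 1 0, 0, H₂ 1 1] : Matrix (Fin 3) (Fin 3) E))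
    (hΓ : P₁ * endoGL (γ₂, u) * P₁⁻¹ ∈ unitaryGroupOfForm σ ((StdForm.antidiagonal 3).over E))
    -- the fence
    {n : ℕ} (hn : mcOfRecord d ≤ n) (hu1N : Valued.v (((u : Matrix (Fin 1) (Fin 1) E) 0 0) - 1) ≤ Valued.v (ϖ ^ n)) (hlam1 : Valued.v (lam - 1) ≤ Valued.v (jE ϖ ^ n))
    -- the cell and its four letters
    {b j : ℕ} (hb1 : 1 ≤ b) (hdb : d ≤ b) (hlamj : IsOrd ρ α (jE ϖ ^ j) lam)
    (hμl : Valued.v (lam - jE ((u : Matrix (Fin 1) (Fin 1) E) 0 0)) ≤ Valued.v (jE ϖ) ^ (d % 2 + 1 + b))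
    (hlamρ : Valued.v (lam - ρ lam) ≤ Valued.v (jE ϖ ^ j * (α - ρ α)) * Valued.v (jE ϖ) ^ (d % 2 + 1))
    (hμk : Valued.v (lam - jE ((u : Matrix (Fin 1) (Fin 1) E) 0 0)) ≤ Valued.v (jE ϖ) ^ (mcOfRecord d - d % 2))
    (hprod : Valued.v (lam - jE ((u : Matrix (Fin 1) (Fin 1) E) 0 0)) * Valued.v ((lam - jE ((u : Matrix (Fin 1) (Fin 1) E) 0 0)) - ρ (lam - jE ((u : Matrix (Fin 1) (Fin 1) E) 0 0))) ≤
      Valued.v (jE ϖ ^ j * (α - ρ α)) * Valued.v (jE ϖ) ^ b * Valued.v (jE ϖ) ^ mcOfRecord d)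
    -- ★ (C1)'s weight letter
    (f : ℕ → ℕ → AddSubgroup M → ℕ)
    (hf : ∀ (b j : ℕ) (Λ : AddSubgroup M) (x₀ : M) (r : E), 1 ≤ b → x₀ ≠ 0 →
      (∀ x, x ∈ Λ ↔ ∃ z, IsOrd ρ α (jE ϖ ^ j) z ∧ x = x₀ * z) →
      IsOrd ρ α (jE ϖ ^ j) (dualGen ρ Θ α (jE ϖ ^ j) h x₀) → ¬ IsOrd ρ α (jE ϖ ^ j) (dualGen ρ Θ α (jE ϖ ^ j) h x₀ / jE ϖ) →
      Valued.v (dualGen ρ Θ α (jE ϖ ^ j) h x₀) = Valued.v (jE ϖ) ^ b →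
      (∀ b', (∀ x ∈ Λ, Valued.v (h * Θ x * b' + ρ (h * Θ x * b')) ≤ 1) → (lam - jE ((u : Matrix (Fin 1) (Fin 1) E) 0 0)) * b' ∈ Λ) →
      IsOrd ρ α (jE ϖ ^ j) lam → jE r = glueUnit ρ Θ α (jE ϖ ^ j) h (jE ϖ) (jE hW) x₀ b →
      f b j Λ = Nat.card {x : 𝒪[E] ⧸ 𝓂[E] ^ (2 * b) // ∃ u' : 𝒪[E], Ideal.Quotient.mk (𝓂[E] ^ (2 * b)) u' = x ∧
        Valued.v ((u' : E) * σ u' - r) ≤ Valued.v (ϖ ^ (2 * b))})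
    -- the exact-level digit and the product class
    (NX : AddSubgroup M → Prop)
    (hNX : ∀ Λ, NX Λ ↔ ∃ (x₀ : M) (e₀ : E), x₀ ≠ 0 ∧ (∀ x, x ∈ Λ ↔ ∃ ζ, IsOrd ρ α (jE ϖ ^ j) ζ ∧ x = x₀ * ζ) ∧
      IsOrd ρ α (jE ϖ ^ j) (dualGen ρ Θ α (jE ϖ ^ j) h x₀) ∧ ¬ IsOrd ρ α (jE ϖ ^ j) (dualGen ρ Θ α (jE ϖ ^ j) h x₀ / jE ϖ) ∧
      Valued.v (dualGen ρ Θ α (jE ϖ ^ j) h x₀) = Valued.v (jE ϖ) ^ b ∧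
      jE e₀ = (lam - jE ((u : Matrix (Fin 1) (Fin 1) E) 0 0)) / (jE ϖ ^ j * (α - ρ α) * Θ (dualGen ρ Θ α (jE ϖ ^ j) h x₀)) +
        ρ ((lam - jE ((u : Matrix (Fin 1) (Fin 1) E) 0 0)) / (jE ϖ ^ j * (α - ρ α) * Θ (dualGen ρ Θ α (jE ϖ ^ j) h x₀))) ∧
      Valued.v e₀ = Valued.v ϖ ^ (d % 2))
    (Pc : AddSubgroup M → Prop)
    (hPc : ∀ Λ, Pc Λ ↔ ∃ (x₀ : M) (r e₀ e' : E), x₀ ≠ 0 ∧ (∀ x, x ∈ Λ ↔ ∃ ζ, IsOrd ρ α (jE ϖ ^ j) ζ ∧ x = x₀ * ζ) ∧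
      IsOrd ρ α (jE ϖ ^ j) (dualGen ρ Θ α (jE ϖ ^ j) h x₀) ∧ ¬ IsOrd ρ α (jE ϖ ^ j) (dualGen ρ Θ α (jE ϖ ^ j) h x₀ / jE ϖ) ∧
      Valued.v (dualGen ρ Θ α (jE ϖ ^ j) h x₀) = Valued.v (jE ϖ) ^ b ∧
      σ r = r ∧ Valued.v r = 1 ∧ jE r = glueUnit ρ Θ α (jE ϖ ^ j) h (jE ϖ) (jE hW) x₀ b ∧
      jE e₀ = (lam - jE ((u : Matrix (Fin 1) (Fin 1) E) 0 0)) / (jE ϖ ^ j * (α - ρ α) * Θ (dualGen ρ Θ α (jE ϖ ^ j) h x₀)) +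
        ρ ((lam - jE ((u : Matrix (Fin 1) (Fin 1) E) 0 0)) / (jE ϖ ^ j * (α - ρ α) * Θ (dualGen ρ Θ α (jE ϖ ^ j) h x₀))) ∧
      σ e' = e' ∧ Valued.v e' = 1 ∧ Valued.v (e₀ - e' * ((ϖ - σ ϖ) * ((ϖ * σ ϖ) ^ ((d - d % 2) / 2))⁻¹)) ≤ Valued.v ϖ ^ mstarOfRecord d ∧
      ∃ c : E, c * σ c = r * e')
    {c₀ : E} (hσc₀ : σ c₀ = c₀) (hc₀1 : Valued.v c₀ = 1) (hc₀N : ¬ ∃ z : E, z * σ z = c₀) :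
    ∀ Λ ∈ levelSetDep ρ Θ α (jE ϖ) h j b (lam - jE ((u : Matrix (Fin 1) (Fin 1) E) 0 0)), f b j Λ ≠ 0 →
      ((∃ B : Submodule 𝒪[E] (Fin 2 → E), B.toAddSubgroup.map φ = Λ ∧
          ∃ L₃ : Submodule 𝒪[E] (Fin 3 → E), IsSelfDualLattice σ ϖ (!![H₂ 0 0, 0, H₂ 0 1; 0, hW, 0; H₂ 1 0, 0, H₂ 1 1] : Matrix (Fin 3) (Fin 3) E) L₃ ∧
            L₃ ⊓ LinearMap.ker ((LinearMap.proj (1 : Fin 3) : (Fin 3 → E) →ₗ[E] E).restrictScalars 𝒪[E]) =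
              B.map ((Matrix.toLin' (!![1, 0; 0, 0; 0, 1] : Matrix (Fin 3) (Fin 2) E)).restrictScalars 𝒪[E]) ∧
            (∀ c : E, (Pi.single 1 c : Fin 3 → E) ∈ L₃ ↔ Valued.v c ≤ Valued.v ϖ ^ b) ∧
            ((LatticeInLevel ϖ (d % 2) ((((endoGL (γ₂, u) : GL (Fin 3) E) : Matrix (Fin 3) (Fin 3) E) - 1)) L₃ ∧
                ¬ LatticeInLevel ϖ (d % 2 + 1) ((((endoGL (γ₂, u) : GL (Fin 3) E) : Matrix (Fin 3) (Fin 3) E) - 1)) L₃) ∧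
              {z : E | ∃ y ∈ L₃, Valued.v ((ϖ ^ (mstarOfRecord d))⁻¹ * (z - pairing σ (!![H₂ 0 0, 0, H₂ 0 1; 0, hW, 0; H₂ 1 0, 0, H₂ 1 1] : Matrix (Fin 3) (Fin 3) E) y
                  (((((endoGL (γ₂, u) : GL (Fin 3) E) : Matrix (Fin 3) (Fin 3) E) - 1)) *ᵥ y))) ≤ 1} = valueSetMod σ ϖ (mstarOfRecord d) (xPlus σ ϖ d))) ↔
        (NX Λ ∧ Pc Λ)) ∧
      ((∃ B : Submodule 𝒪[E] (Fin 2 → E), B.toAddSubgroup.map φ = Λ ∧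
          ∃ L₃ : Submodule 𝒪[E] (Fin 3 → E), IsSelfDualLattice σ ϖ (!![H₂ 0 0, 0, H₂ 0 1; 0, hW, 0; H₂ 1 0, 0, H₂ 1 1] : Matrix (Fin 3) (Fin 3) E) L₃ ∧
            L₃ ⊓ LinearMap.ker ((LinearMap.proj (1 : Fin 3) : (Fin 3 → E) →ₗ[E] E).restrictScalars 𝒪[E]) =
              B.map ((Matrix.toLin' (!![1, 0; 0, 0; 0, 1] : Matrix (Fin 3) (Fin 2) E)).restrictScalars 𝒪[E]) ∧
            (∀ c : E, (Pi.single 1 c : Fin 3 → E) ∈ L₃ ↔ Valued.v c ≤ Valued.v ϖ ^ b) ∧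
            ((LatticeInLevel ϖ (d % 2) ((((endoGL (γ₂, u) : GL (Fin 3) E) : Matrix (Fin 3) (Fin 3) E) - 1)) L₃ ∧
                ¬ LatticeInLevel ϖ (d % 2 + 1) ((((endoGL (γ₂, u) : GL (Fin 3) E) : Matrix (Fin 3) (Fin 3) E) - 1)) L₃) ∧
              {z : E | ∃ y ∈ L₃, Valued.v ((ϖ ^ (mstarOfRecord d))⁻¹ * (z - pairing σ (!![H₂ 0 0, 0, H₂ 0 1; 0, hW, 0; H₂ 1 0, 0, H₂ 1 1] : Matrix (Fin 3) (Fin 3) E) y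
                  (((((endoGL (γ₂, u) : GL (Fin 3) E) : Matrix (Fin 3) (Fin 3) E) - 1)) *ᵥ y))) ≤ 1} = valueSetMod σ ϖ (mstarOfRecord d) (c₀ • xPlus σ ϖ d))) ↔
        (NX Λ ∧ ¬ Pc Λ)) := by
  haveI := isAdicComplete_valuedInteger_of_completeSpace (K := E) hϖ
  have hd : Valued.v (ϖ - σ ϖ) = Valued.v ϖ ^ d := hD.2.2.2.2.1
  have hms : mstarOfRecord d = d % 2 + 2 * d - 1 := rfl
  have hmc : mcOfRecord d = 2 * ((mstarOfRecord d + d) / 2) := rfl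
  have hd1 : 1 ≤ d := hD.2.2.2.2.2.1
  have hvϖ0 : Valued.v ϖ ≠ 0 := by rw [hϖ]; exact exp_ne_zero
  have hϖ0 : ϖ ≠ 0 := fun h0 => hvϖ0 (by rw [h0, map_zero])
  have hϖlt : Valued.v ϖ < 1 := by rw [hϖ, ← exp_zero, exp_lt_exp]; norm_num
  have hϖle : Valued.v ϖ ≤ 1 := hϖlt.le
  have hjϖ0 : jE ϖ ≠ 0 := (map_ne_zero jE).2 hϖ0
  have hjϖle : Valued.v (jE ϖ) ≤ 1 := (hjv ϖ).2 hϖle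
  have hρϖ : ρ (jE ϖ) = jE ϖ := (hjfix _).2 ⟨ϖ, rfl⟩
  have hα0 : α - ρ α ≠ 0 := sub_ne_zero.2 (Ne.symm hα)
  have hc : ρ (jE ϖ ^ j) = jE ϖ ^ j := by rw [map_pow, hρϖ]
  have hc0 : jE ϖ ^ j ≠ 0 := pow_ne_zero j hjϖ0
  have hcc : jE ϖ ^ j * (α - ρ α) ≠ 0 := mul_ne_zero hc0 hα0
  set H : Matrix (Fin 3) (Fin 3) E := !![H₂ 0 0, 0, H₂ 0 1; 0, hW, 0; H₂ 1 0, 0, H₂ 1 1] with hHdef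
  set X : Matrix (Fin 3) (Fin 3) E := (((endoGL (γ₂, u) : GL (Fin 3) E) : Matrix (Fin 3) (Fin 3) E) - 1) with hXdef
  set tp : E := (ϖ - σ ϖ) * ((ϖ * σ ϖ) ^ ((d - d % 2) / 2))⁻¹ with htp
  have hvt : Valued.v tp = Valued.v ϖ ^ (d % 2) := v_refSkew_eq hvσ hϖ hd
  have htp0 : tp ≠ 0 := fun h0 => by rw [h0, map_zero] at hvt; exact pow_ne_zero _ hvϖ0 hvt.symm
  have hpm0 : (0 : ℤᵐ⁰) < Valued.v (ϖ ^ mstarOfRecord d) := by rw [map_pow]; exact pow_pos (zero_lt_iff.2 hvϖ0) _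
  have hmlt : Valued.v ϖ ^ mstarOfRecord d < Valued.v ϖ ^ (d % 2) :=
    pow_lt_pow_right_of_lt_one₀ (zero_lt_iff.2 hvϖ0) hϖlt (by rw [hms]; omega)
  -- the fence at the levels used below
  have hpowE : ∀ {k l : ℕ}, k ≤ l → Valued.v (ϖ ^ l) ≤ Valued.v (ϖ ^ k) := fun hkl => by
    rw [map_pow, map_pow]; exact pow_le_pow_right_of_le_one' hϖle hkl
  have hul : Valued.v ((u : Matrix (Fin 1) (Fin 1) E) 0 0 - 1) ≤ Valued.v (ϖ ^ (d % 2 + 1)) := hu1N.trans (hpowE (by rw [hmc, hms] at hn; omega))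
  have huk : Valued.v ((u : Matrix (Fin 1) (Fin 1) E) 0 0 - 1) ≤ Valued.v (ϖ ^ (mcOfRecord d - d % 2)) := hu1N.trans (hpowE (by omega))
  have hum : Valued.v ((u : Matrix (Fin 1) (Fin 1) E) 0 0 - 1) ≤ Valued.v (ϖ ^ mstarOfRecord d) :=
    hu1N.trans (hpowE ((mstarOfRecord_le_mcOfRecord d).trans hn))
  have hlam1' : Valued.v (lam - 1) ≤ Valued.v (jE ϖ) ^ (d % 2 + 1) :=
    hlam1.trans (by rw [map_pow]; exact pow_le_pow_right_of_le_one' hjϖle (by rw [hmc, hms] at hn; omega))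
  -- the form is integral on a self-dual lattice
  have hintL : ∀ L : Submodule 𝒪[E] (Fin 3 → E), IsSelfDualLattice σ ϖ H L → ∀ y ∈ L, Valued.v (pairing σ H y y) ≤ 1 :=
    fun L hL y hy => (mem_dualLatt σ H L y).1 (le_dualLatt_of_isVertexLattice hvσ hL hy) y hy
  intro Λ hΛ hfne
  -- (i)+(ii): for ANY glued `L₃` and ANY presentation `x₁` with ray scalar `e₁`: «exact level ⟺ |e₁| = |ϖ|^{ℓ₀}», «e₁ is a value mod ϖ^{m⋆}», «exact level ⟹ shell»
  have hframe : ∀ (B : Submodule 𝒪[E] (Fin 2 → E)) (L₃ : Submodule 𝒪[E] (Fin 3 → E)), B.toAddSubgroup.map φ = Λ → IsSelfDualLattice σ ϖ H L₃ →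
      L₃ ⊓ LinearMap.ker ((LinearMap.proj (1 : Fin 3) : (Fin 3 → E) →ₗ[E] E).restrictScalars 𝒪[E]) =
        B.map ((Matrix.toLin' (!![1, 0; 0, 0; 0, 1] : Matrix (Fin 3) (Fin 2) E)).restrictScalars 𝒪[E]) →
      (∀ c : E, (Pi.single 1 c : Fin 3 → E) ∈ L₃ ↔ Valued.v c ≤ Valued.v ϖ ^ b) →
      ∀ (x₁ : M) (e₁ : E), x₁ ≠ 0 → (∀ x, x ∈ Λ ↔ ∃ ζ, IsOrd ρ α (jE ϖ ^ j) ζ ∧ x = x₁ * ζ) →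
      IsOrd ρ α (jE ϖ ^ j) (dualGen ρ Θ α (jE ϖ ^ j) h x₁) → ¬ IsOrd ρ α (jE ϖ ^ j) (dualGen ρ Θ α (jE ϖ ^ j) h x₁ / jE ϖ) →
      Valued.v (dualGen ρ Θ α (jE ϖ ^ j) h x₁) = Valued.v (jE ϖ) ^ b →
      jE e₁ = (lam - jE ((u : Matrix (Fin 1) (Fin 1) E) 0 0)) / (jE ϖ ^ j * (α - ρ α) * Θ (dualGen ρ Θ α (jE ϖ ^ j) h x₁)) +
        ρ ((lam - jE ((u : Matrix (Fin 1) (Fin 1) E) 0 0)) / (jE ϖ ^ j * (α - ρ α) * Θ (dualGen ρ Θ α (jE ϖ ^ j) h x₁))) →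
      ((LatticeInLevel ϖ (d % 2) X L₃ ∧ ¬ LatticeInLevel ϖ (d % 2 + 1) X L₃) ↔ Valued.v e₁ = Valued.v ϖ ^ (d % 2)) ∧
        (∃ y ∈ L₃, Valued.v ((ϖ ^ mstarOfRecord d)⁻¹ * (e₁ - pairing σ H y (X *ᵥ y))) ≤ 1) ∧
        ((LatticeInLevel ϖ (d % 2) X L₃ ∧ ¬ LatticeInLevel ϖ (d % 2 + 1) X L₃) → LatticeNearTransvShell ϖ (d % 2) (mcOfRecord d) X L₃) := by
    intro B L₃ hBΛ hL hLB htube x₁ e₁ hx₁ hΛx₁ hyO₁ hyp₁ hylev₁ he₁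
    have hY0 : dualGen ρ Θ α (jE ϖ ^ j) h x₁ ≠ 0 := fun h0 => by
      rw [h0, map_zero] at hylev₁; exact pow_ne_zero b ((Valuation.ne_zero_iff _).2 hjϖ0) hylev₁.symm
    obtain ⟨w₀, g₀, hw₀Y, hpr, hg₀, hg₀1, hprg⟩ := exists_glueLetters_of_gen σ hσ hvσ hϖ hH₂ hH₂σ hhW jE hρρ hvρ hα hα1 hint hΘΘ hΘρ hvΘ hjv hjfix hjpow hϖmax
      φ hφs hφi hφo hφγ hlam hΘh hh hform ((u : Matrix (Fin 1) (Fin 1) E) 0 0) hb1 hlamj hx₁ hΛx₁ hyO₁ hyp₁ hylev₁ hΛ.2 hBΛ hL hLB htube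
    refine ⟨?_, ?_, fun hex => ?_⟩
    · -- ★ p864080 at level `ℓ₀ + 1`
      have hμl' : Valued.v (lam - jE ((u : Matrix (Fin 1) (Fin 1) E) 0 0)) ≤ Valued.v (jE ϖ ^ (d % 2 + 1) * dualGen ρ Θ α (jE ϖ ^ j) h x₁) := by
        rw [Valuation.map_mul, Valuation.map_pow, hylev₁, ← pow_add]; exact hμl
      exact exactLevel_iff_v_rayScalar_eq hρρ hvρ hΘΘ hΘρ hvΘ hϖ jE hjv hρϖ φ hφs hφi hφγ hΘh htube hpr hLB.symm hg₀ hg₀1 hprg hBΛ hc hcc hx₁ hY0 hΛx₁ hw₀Y u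
        (d % 2) hul hlam1' hlamρ hμl' he₁
    · -- the ray scalar is the norm-form value at `ζ = 0`, `a = 1`
      have hmem : e₁ ∈ {z : E | ∃ y ∈ L₃, Valued.v ((ϖ ^ mstarOfRecord d)⁻¹ * (z - pairing σ H y (X *ᵥ y))) ≤ 1} := by
        rw [valueSet_endoGL_sub_one_glued_eq_normFormSet_of_gen σ hϖ H₂ hW jE hjv hΘΘ φ hφs hφγ hh hform hpr (hintL L₃ hL) hLB.symm hg₀ hg₀1 hprg u
          (mstarOfRecord d) hum hcc hx₁ hBΛ hΛx₁ hw₀Y, Set.mem_setOf_eq]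
        refine ⟨0, 1, ⟨by rw [map_zero]; exact zero_le, by rw [map_zero, sub_zero, map_zero]; exact zero_le⟩, by rw [map_one], ?_⟩
        have e : (dualGen ρ Θ α (jE ϖ ^ j) h x₁ * 0 + jE 1) * Θ (dualGen ρ Θ α (jE ϖ ^ j) h x₁ * 0 + jE 1) = 1 := by
          rw [mul_zero, zero_add, map_one, map_one, mul_one]
        rw [e, mul_one, ← he₁, sub_self, mul_zero, map_zero]; exact zero_le
      exact hmem
    · exact (latticeNearTransvShell_iff_exactLevel_of_prod hvρ hϖ jE hjv hjfix φ hφs hφi hφγ htube hpr hLB.symm hg₀ hg₀1 hprg hBΛ hx₁ hΛx₁ hw₀Y hylev₁ u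
        (d % 2) (mcOfRecord d - d % 2) (mcOfRecord d) (by have := mstarOfRecord_le_mcOfRecord d; rw [hms] at this; omega) huk hμk
        (by rw [hylev₁]; exact hprod)).2 hex
  -- a ray scalar exists on every presentation (the trace is `ρ`-fixed)
  have hray : ∀ x₁ : M, ∃ e₁ : E, jE e₁ = (lam - jE ((u : Matrix (Fin 1) (Fin 1) E) 0 0)) / (jE ϖ ^ j * (α - ρ α) * Θ (dualGen ρ Θ α (jE ϖ ^ j) h x₁)) +
      ρ ((lam - jE ((u : Matrix (Fin 1) (Fin 1) E) 0 0)) / (jE ϖ ^ j * (α - ρ α) * Θ (dualGen ρ Θ α (jE ϖ ^ j) h x₁))) := fun x₁ =>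
    (hjfix _).1 (by rw [map_add, hρρ, add_comm])
  -- the member's own presentation (from the cell) reads the digit on every glued vertex
  obtain ⟨xc, hxc, hΛxc, hyOc, hypc, hylevc⟩ := hΛ.1
  obtain ⟨ec, hec⟩ := hray xc
  have hNXof : ∀ (B : Submodule 𝒪[E] (Fin 2 → E)) (L₃ : Submodule 𝒪[E] (Fin 3 → E)), B.toAddSubgroup.map φ = Λ → IsSelfDualLattice σ ϖ H L₃ →
      L₃ ⊓ LinearMap.ker ((LinearMap.proj (1 : Fin 3) : (Fin 3 → E) →ₗ[E] E).restrictScalars 𝒪[E]) =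
        B.map ((Matrix.toLin' (!![1, 0; 0, 0; 0, 1] : Matrix (Fin 3) (Fin 2) E)).restrictScalars 𝒪[E]) →
      (∀ c : E, (Pi.single 1 c : Fin 3 → E) ∈ L₃ ↔ Valued.v c ≤ Valued.v ϖ ^ b) →
      ((LatticeInLevel ϖ (d % 2) X L₃ ∧ ¬ LatticeInLevel ϖ (d % 2 + 1) X L₃) ↔ NX Λ) := by
    intro B L₃ hBΛ hL hLB htube
    constructor
    · intro hex
      exact (hNX Λ).2 ⟨xc, ec, hxc, hΛxc, hyOc, hypc, hylevc, hec, ((hframe B L₃ hBΛ hL hLB htube xc ec hxc hΛxc hyOc hypc hylevc hec).1).1 hex⟩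
    · rintro hN
      obtain ⟨x₀, e₀, hx₀, hΛx, hyO, hyp, hylev, he₀, he₀v⟩ := (hNX Λ).1 hN
      exact ((hframe B L₃ hBΛ hL hLB htube x₀ e₀ hx₀ hΛx hyO hyp hylev he₀).1).2 he₀v
  -- (iii) THE LABEL LAW on an exact-level glued vertex (★ FILE 10 shell + ★ p864323 §3)
  have hLab : ∀ (B : Submodule 𝒪[E] (Fin 2 → E)) (L₃ : Submodule 𝒪[E] (Fin 3 → E)), B.toAddSubgroup.map φ = Λ → IsSelfDualLattice σ ϖ H L₃ →
      L₃ ⊓ LinearMap.ker ((LinearMap.proj (1 : Fin 3) : (Fin 3 → E) →ₗ[E] E).restrictScalars 𝒪[E]) =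
        B.map ((Matrix.toLin' (!![1, 0; 0, 0; 0, 1] : Matrix (Fin 3) (Fin 2) E)).restrictScalars 𝒪[E]) →
      (∀ c : E, (Pi.single 1 c : Fin 3 → E) ∈ L₃ ↔ Valued.v c ≤ Valued.v ϖ ^ b) →
      (LatticeInLevel ϖ (d % 2) X L₃ ∧ ¬ LatticeInLevel ϖ (d % 2 + 1) X L₃) →
      ∃ e₃ : E, σ e₃ = e₃ ∧ Valued.v e₃ = 1 ∧
        {z : E | ∃ y ∈ L₃, Valued.v ((ϖ ^ mstarOfRecord d)⁻¹ * (z - pairing σ H y (X *ᵥ y))) ≤ 1} = valueSetMod σ ϖ (mstarOfRecord d) (e₃ • xPlus σ ϖ d) := by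
    intro B L₃ hBΛ hL hLB htube hex
    exact exists_fixed_unit_valueSet_eq_smul_xPlus_of_shell_offBlock σ ϖ d t hD h2 jE ρ lam hvρ hjiso γ₂ u hlam2 hρlam hn hu1N hlam1 H₂ hW hH₂σ hhWσ P₁ hA hΓ hL
      ((hframe B L₃ hBΛ hL hLB htube xc ec hxc hΛxc hyOc hypc hylevc hec).2.2 hex)
  -- `V(X₊) → Pc`: the canonical datum is a norm (populated), and `e₀ ≡ t₊·aσa`
  have hSPc : ∀ (B : Submodule 𝒪[E] (Fin 2 → E)) (L₃ : Submodule 𝒪[E] (Fin 3 → E)), B.toAddSubgroup.map φ = Λ → IsSelfDualLattice σ ϖ H L₃ →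
      L₃ ⊓ LinearMap.ker ((LinearMap.proj (1 : Fin 3) : (Fin 3 → E) →ₗ[E] E).restrictScalars 𝒪[E]) =
        B.map ((Matrix.toLin' (!![1, 0; 0, 0; 0, 1] : Matrix (Fin 3) (Fin 2) E)).restrictScalars 𝒪[E]) →
      (∀ c : E, (Pi.single 1 c : Fin 3 → E) ∈ L₃ ↔ Valued.v c ≤ Valued.v ϖ ^ b) →
      (LatticeInLevel ϖ (d % 2) X L₃ ∧ ¬ LatticeInLevel ϖ (d % 2 + 1) X L₃) →
      {z : E | ∃ y ∈ L₃, Valued.v ((ϖ ^ mstarOfRecord d)⁻¹ * (z - pairing σ H y (X *ᵥ y))) ≤ 1} = valueSetMod σ ϖ (mstarOfRecord d) (xPlus σ ϖ d) → Pc Λ := by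
    intro B L₃ hBΛ hL hLB htube hex hVS
    obtain ⟨x₀, r₀, hx₀, hΛx, hyO, hyp, hylev, -, hσr₀, hr₀1, hr₀, hfΛ⟩ := exists_fixed_unit_weight_eq_natCard_normFibre σ hσ hvσ hϖ hH₂σ hhW hhWσ jE hρρ hvρ hα hα1
      hint hΘΘ hΘρ hvΘ hΘj hjv hjfix hjpow hϖmax φ hφs hφi hφo hφγ hlam hΘh hh hform ((u : Matrix (Fin 1) (Fin 1) E) 0 0) hb1 hlamj f hf hΛ
    have hN₀ : ∃ e : E, e * σ e = r₀ := by
      by_contra hN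
      exact hfne (hfΛ.trans (natCard_normFibre_eq_zero_of_not_exists_of_le hD hσr₀ hr₀1 hN hdb))
    obtain ⟨e₀, he₀⟩ := hray x₀
    obtain ⟨hEX, ⟨y, hy, hyv⟩, -⟩ := hframe B L₃ hBΛ hL hLB htube x₀ e₀ hx₀ hΛx hyO hyp hylev he₀
    have he₀v : Valued.v e₀ = Valued.v ϖ ^ (d % 2) := hEX.1 hex
    have hmem : e₀ ∈ valueSetMod σ ϖ (mstarOfRecord d) ((1 : E) • xPlus σ ϖ d) := by rw [one_smul, ← hVS]; exact ⟨y, hy, hyv⟩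
    rw [valueSetMod_smul_xPlus] at hmem
    obtain ⟨a, -, hclose⟩ := hmem
    rw [one_mul, Valuation.map_mul, map_inv₀, inv_mul_le_iff₀ hpm0, mul_one, map_pow, show tp * (a * σ a) = (a * σ a) * tp from mul_comm _ _] at hclose
    have he'σ : σ (a * σ a) = a * σ a := by rw [map_mul, hσ, mul_comm]
    have he'1 : Valued.v (a * σ a) = 1 := by
      have hlt : Valued.v (a * σ a * tp - e₀) < Valued.v e₀ := by rw [Valuation.map_sub_swap, he₀v]; exact hclose.trans_lt hmlt
      have heq := Valuation.map_eq_of_sub_lt Valued.v hlt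
      rw [Valuation.map_mul, hvt, he₀v] at heq
      exact mul_right_cancel₀ (pow_ne_zero _ hvϖ0) (heq.trans (one_mul _).symm)
    obtain ⟨c₁, hc₁⟩ := hN₀
    exact (hPc Λ).2 ⟨x₀, r₀, e₀, a * σ a, hx₀, hΛx, hyO, hyp, hylev, hσr₀, hr₀1, hr₀, he₀, he'σ, he'1, hclose, c₁ * a,
      by rw [map_mul, mul_mul_mul_comm, hc₁]⟩
  -- `Pc → V(X₊)`: the witness's `r` is a norm (populated), hence `e′` is; ★ p864505 reads the class off the value `e₁ ≈ e′t₊`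
  have hPcS : ∀ (B : Submodule 𝒪[E] (Fin 2 → E)) (L₃ : Submodule 𝒪[E] (Fin 3 → E)), B.toAddSubgroup.map φ = Λ → IsSelfDualLattice σ ϖ H L₃ →
      L₃ ⊓ LinearMap.ker ((LinearMap.proj (1 : Fin 3) : (Fin 3 → E) →ₗ[E] E).restrictScalars 𝒪[E]) =
        B.map ((Matrix.toLin' (!![1, 0; 0, 0; 0, 1] : Matrix (Fin 3) (Fin 2) E)).restrictScalars 𝒪[E]) →
      (∀ c : E, (Pi.single 1 c : Fin 3 → E) ∈ L₃ ↔ Valued.v c ≤ Valued.v ϖ ^ b) →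
      (LatticeInLevel ϖ (d % 2) X L₃ ∧ ¬ LatticeInLevel ϖ (d % 2 + 1) X L₃) → Pc Λ →
      {z : E | ∃ y ∈ L₃, Valued.v ((ϖ ^ mstarOfRecord d)⁻¹ * (z - pairing σ H y (X *ᵥ y))) ≤ 1} = valueSetMod σ ϖ (mstarOfRecord d) (xPlus σ ϖ d) := by
    intro B L₃ hBΛ hL hLB htube hex hP
    obtain ⟨x₁, r₁, e₁, e', hx₁, hΛx₁, hyO₁, hyp₁, hylev₁, hσr₁, hr₁1, hr₁, he₁, hσe', he'1, hclose, c, hc⟩ := (hPc Λ).1 hP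
    have hf₁ := hf b j Λ x₁ r₁ hb1 hx₁ hΛx₁ hyO₁ hyp₁ hylev₁ hΛ.2 hlamj hr₁
    have hN₁ : ∃ e : E, e * σ e = r₁ := by
      by_contra hN
      exact hfne (hf₁.trans (natCard_normFibre_eq_zero_of_not_exists_of_le hD hσr₁ hr₁1 hN hdb))
    have hr₁0 : r₁ ≠ 0 := fun h0 => by rw [h0, map_zero] at hr₁1; exact zero_ne_one hr₁1
    have hNe' : ∃ z : E, z * σ z = e' := by
      obtain ⟨e, he⟩ := hN₁
      have he0 : e ≠ 0 := fun h0 => hr₁0 (by rw [← he, h0, zero_mul])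
      refine ⟨c / e, ?_⟩
      rw [map_div₀, div_mul_div_comm, hc, he, mul_div_cancel_left₀ _ hr₁0]
    obtain ⟨-, ⟨y, hy, hyv⟩, -⟩ := hframe B L₃ hBΛ hL hLB htube x₁ e₁ hx₁ hΛx₁ hyO₁ hyp₁ hylev₁ he₁
    obtain ⟨e₃, he₃σ, he₃1, hS⟩ := hLab B L₃ hBΛ hL hLB htube hex
    -- `|val y − e′t₊| ≤ |ϖ|^{m⋆}`
    rw [Valuation.map_mul, map_inv₀, inv_mul_le_iff₀ hpm0, mul_one, map_pow] at hyv
    have hclose' : Valued.v (pairing σ H y (X *ᵥ y) - e' * tp) ≤ Valued.v ϖ ^ mstarOfRecord d := by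
      rw [show pairing σ H y (X *ᵥ y) - e' * tp = (e₁ - e' * tp) - (e₁ - pairing σ H y (X *ᵥ y)) by ring]
      exact (Valuation.map_sub _ _ _).trans (max_le hclose hyv)
    exact (eq_plus_iff_exists_norm_of_value_near_fixed (L := (L₃ : Set (Fin 3 → E))) (val := fun y => pairing σ H y (X *ᵥ y))
      hD he₃σ he₃1 hS hy hσe' he'1 hclose').2 hNe'
  -- populated ⇒ glued
  have hglued := exists_glued_of_mem_levelSetDep_of_weight_ne_zero σ hσ hvσ hϖ hH₂ hH₂σ hhW hhWσ jE hρρ hvρ hα hα1 hint hΘΘ hΘρ hvΘ hΘj hjv hjfix hjpow hϖmax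
    φ hφs hφi hφo hφγ hlam hΘh hh hform ((u : Matrix (Fin 1) (Fin 1) E) 0 0) hb1 hlamj f hf hΛ hfne
  refine ⟨⟨fun hP => ?_, fun hNP => ?_⟩, ⟨fun hQ => ?_, fun hNQ => ?_⟩⟩
  · obtain ⟨B, hBΛ, L₃, hL, hLB, htube, hex, hVS⟩ := hP
    exact ⟨(hNXof B L₃ hBΛ hL hLB htube).1 hex, hSPc B L₃ hBΛ hL hLB htube hex hVS⟩
  · obtain ⟨hN, hP⟩ := hNP
    obtain ⟨B, hBΛ, L₃, hL, hLB, htube⟩ := hglued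
    have hex := (hNXof B L₃ hBΛ hL hLB htube).2 hN
    exact ⟨B, hBΛ, L₃, hL, hLB, htube, hex, hPcS B L₃ hBΛ hL hLB htube hex hP⟩
  · obtain ⟨B, hBΛ, L₃, hL, hLB, htube, hex, hVSc⟩ := hQ
    refine ⟨(hNXof B L₃ hBΛ hL hLB htube).1 hex, fun hP => hc₀N ?_⟩
    have hVS := hPcS B L₃ hBΛ hL hLB htube hex hP
    rw [hVSc] at hVS
    exact (valueSetMod_smul_xPlus_eq_plus_iff_exists_norm hD hσc₀ hc₀1).1 hVS
  · obtain ⟨hN, hnP⟩ := hNQ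
    obtain ⟨B, hBΛ, L₃, hL, hLB, htube⟩ := hglued
    have hex := (hNXof B L₃ hBΛ hL hLB htube).2 hN
    refine ⟨B, hBΛ, L₃, hL, hLB, htube, hex, ?_⟩
    obtain ⟨e₃, he₃σ, he₃1, hS⟩ := hLab B L₃ hBΛ hL hLB htube hex
    rw [hS, valueSetMod_smul_xPlus_eq_iff_exists_norm hD he₃σ he₃1 hσc₀ hc₀1]
    refine exists_norm_mul_inv_of_not_norm hD he₃σ (fun hN3 => hnP ?_) hσc₀ hc₀N
    have hVS : {z : E | ∃ y ∈ L₃, Valued.v ((ϖ ^ mstarOfRecord d)⁻¹ * (z - pairing σ H y (X *ᵥ y))) ≤ 1} = valueSetMod σ ϖ (mstarOfRecord d) (xPlus σ ϖ d) := by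
      rw [hS]; exact (valueSetMod_smul_xPlus_eq_plus_iff_exists_norm hD he₃σ he₃1).2 hN3
    exact hSPc B L₃ hBΛ hL hLB htube hex hVS

end Summit.HodgeConjecture.HodgeConjecture.Cruxes.H413.F0P3cDyRamMixBandProductRead

end
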